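import Summits.HodgeConjecture.HodgeConjecture.Theorems.K2E3LocalUnitaryWittRefinement   -- ★ `wittPos`, `wittBlockNat_mono_pos` (+ D₁ parts 1∕2, 2∕2)
import HarnessLib

/-!
# K2 ∕ E3 «EllipticInputs», 13a road A — DEFS LEAF D₁ (supplement 2) `K2E3LocalUnitaryWittStdFrame`: the STANDARD bijection
# `stdWittEquiv r m : WittIndex r m ≃ Fin (r + (m + r))` and monotonicity of the block labellings along it

Cell `hodgecm-mathlib` (Track B «K2-LIT»), item h413 = `stmt-HodgeConjecture-24833`, line `K2_E3_EllipticInputs`, socket U12-g ∕ 13a road A; author K2-defs1 (g2)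
on K2E3-p10 (g2)'s request (K2/STATUS 2026-09-03T23:42:20Z, item (ii)); count-neutral; `--supports … --as helper`; namespace of ★ `K2E3LocalUnitaryWittDefs`.
No `sorry`, no named fact, no `instance`, no `notation`.

CONTENT.  `stdWittEquiv r m := (Equiv.sumCongr (Equiv.refl (Fin r)) finSumFinEquiv).trans finSumFinEquiv` sends `e_{i+1} ↦ i`, the middle index `u ↦ r + u`,
the `f`-slot `j ↦ r + (m + j)` (`stdWittEquiv_inl ∕ _inr_inl ∕ _inr_inr`, `val_stdWittEquiv_*`); `stdWittEquivFin h : WittIndex r m ≃ Fin N` for `h : r + (m + r) = N`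
(composition with Mathlib `finCongr`).  Along it the flag order `wittPos` is respected (`wittPos_le_of_stdWittEquiv_le`), hence every block labelling is
MONOTONE: **`wittBlockOn_stdWittEquiv_monotone S : Monotone (wittBlockOn (stdWittEquiv r m) S)`** and `wittBlockOn_stdWittEquivFin_monotone` — the `Monotone c`
hypothesis of ★ `isLimitOfCompactOpen_unipotentRadicalGL` ∕ ★ `exists_borel_mul_mem_cmLocalIntegralLevel`-style statements on `Fin N` carriers, so that in the
standard frame `wittFormOn (stdWittEquivFin h) Han` the parabolics `P_S` are block-upper-triangular for an INCREASING labelling of `Fin N` (and, for `m ≤ 1`,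
`Han = (1)`, the form is Mok's `Φ_N` — K2E3-p10's item (i)).

HONEST LABEL: HC_CM is proved only modulo the 7 printed citations (2 remaining named inputs: hLiu418 = stmt-HodgeConjecture-24832, h413 =
stmt-HodgeConjecture-24833) until rung 0 closes; this file is count-neutral.

## References
* [Borel1991] A. Borel, *Linear Algebraic Groups*, 2nd ed. (1991), §23 (standard parabolics as stabilisers of isotropic flags).
* [BernsteinZelevinsky1977] I. N. Bernstein, A. V. Zelevinsky, Ann. Sci. ÉNS 10 (1977), §2.1 (block-upper-triangular standard parabolics of `GL_n`).
-/

set_option autoImplicit false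
-- the mandated namespace repeats `HodgeConjecture.HodgeConjecture`, as in every `Theorems/*.lean` of this sub-problem
set_option linter.dupNamespace false

namespace Summit.HodgeConjecture.HodgeConjecture.Cruxes.H413.K2E3LocalUnitaryWitt

open Literature.NumberTheory.Automorphic

section StdFrame

variable (r m : ℕ)

/-- The **standard bijection** `WittIndex r m ≃ Fin (r + (m + r))`: `e₁…e_r` first, then the middle block, then the `f`-slots `f_r…f₁` (Mathlib `finSumFinEquiv`
twice). [cite: Borel1991, §23] -/
def stdWittEquiv : WittIndex r m ≃ Fin (r + (m + r)) :=
  (Equiv.sumCongr (Equiv.refl (Fin r)) finSumFinEquiv).trans finSumFinEquiv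

variable {r m}

/-- `stdWittEquiv` on `e_{i+1}`: `Fin.castAdd (m + r) i` (value `i`). [cite: Borel1991, §23] -/
@[simp] theorem stdWittEquiv_inl (i : Fin r) : stdWittEquiv r m (Sum.inl i) = Fin.castAdd (m + r) i := by
  simp [stdWittEquiv]

/-- `stdWittEquiv` on a middle index `u`: `Fin.natAdd r (Fin.castAdd r u)` (value `r + u`). [cite: Borel1991, §23] -/
@[simp] theorem stdWittEquiv_inr_inl (u : Fin m) : stdWittEquiv r m (Sum.inr (Sum.inl u)) = Fin.natAdd r (Fin.castAdd r u) := by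
  simp [stdWittEquiv]

/-- `stdWittEquiv` on the `f`-slot `j`: `Fin.natAdd r (Fin.natAdd m j)` (value `r + (m + j)`). [cite: Borel1991, §23] -/
@[simp] theorem stdWittEquiv_inr_inr (j : Fin r) : stdWittEquiv r m (Sum.inr (Sum.inr j)) = Fin.natAdd r (Fin.natAdd m j) := by
  simp [stdWittEquiv]

/-- Value on `e_{i+1}`: `i`. [cite: Borel1991, §23] -/
theorem val_stdWittEquiv_inl (i : Fin r) : (stdWittEquiv r m (Sum.inl i)).val = i.val := by simp

/-- Value on a middle index: `r + u`. [cite: Borel1991, §23] -/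
theorem val_stdWittEquiv_inr_inl (u : Fin m) : (stdWittEquiv r m (Sum.inr (Sum.inl u))).val = r + u.val := by simp

/-- Value on the `f`-slot `j`: `r + (m + j)`. [cite: Borel1991, §23] -/
theorem val_stdWittEquiv_inr_inr (j : Fin r) : (stdWittEquiv r m (Sum.inr (Sum.inr j))).val = r + (m + j.val) := by simp

/-- **The standard bijection respects the flag order**: `stdWittEquiv x ≤ stdWittEquiv y → wittPos x ≤ wittPos y`. [cite: Borel1991, §23] -/
theorem wittPos_le_of_stdWittEquiv_le {x y : WittIndex r m} (h : stdWittEquiv r m x ≤ stdWittEquiv r m y) : wittPos x ≤ wittPos y := by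
  rw [Fin.le_iff_val_le_val] at h
  rcases x with i | u | j <;> rcases y with i' | u' | j' <;>
    simp only [stdWittEquiv_inl, stdWittEquiv_inr_inl, stdWittEquiv_inr_inr, Fin.val_castAdd, Fin.val_natAdd, wittPos] at h ⊢ <;> omega

/-- **Every block labelling is MONOTONE along the standard bijection** (labels increase along `e₁…e_r ∣ mid ∣ f_r…f₁`). [cite: Borel1991, §23]
[cite: BernsteinZelevinsky1977, §2.1] -/
theorem wittBlockOn_stdWittEquiv_monotone (S : Finset (Fin r)) : Monotone (wittBlockOn (stdWittEquiv r m) S) := by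
  intro k l hkl
  rw [Fin.le_iff_val_le_val, wittBlockOn_apply, wittBlockOn_apply, wittBlock_val, wittBlock_val]
  refine wittBlockNat_mono_pos S (wittPos_le_of_stdWittEquiv_le ?_)
  rwa [Equiv.apply_symm_apply, Equiv.apply_symm_apply]

variable (r m)

/-- The standard bijection onto `Fin N` for `N = r + (m + r)` (`= 2r + m`): `stdWittEquiv` followed by Mathlib `finCongr`. [cite: Borel1991, §23] -/
def stdWittEquivFin {N : ℕ} (h : r + (m + r) = N) : WittIndex r m ≃ Fin N := (stdWittEquiv r m).trans (finCongr h)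

variable {r m}

/-- Values are unchanged by the cast: `(stdWittEquivFin h x).val = (stdWittEquiv x).val`. [cite: Borel1991, §23] -/
@[simp] theorem val_stdWittEquivFin {N : ℕ} (h : r + (m + r) = N) (x : WittIndex r m) :
    (stdWittEquivFin r m h x).val = (stdWittEquiv r m x).val := by
  simp [stdWittEquivFin]

/-- **Monotone labelling on `Fin N`**: `Monotone (wittBlockOn (stdWittEquivFin h) S)` — the `Monotone c` hypothesis of the ★ `GL_N` radical ∕ Iwasawa statements
in the standard Witt frame. [cite: Borel1991, §23] [cite: BernsteinZelevinsky1977, §2.1] -/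
theorem wittBlockOn_stdWittEquivFin_monotone {N : ℕ} (h : r + (m + r) = N) (S : Finset (Fin r)) :
    Monotone (wittBlockOn (stdWittEquivFin r m h) S) := by
  intro k l hkl
  rw [Fin.le_iff_val_le_val, wittBlockOn_apply, wittBlockOn_apply, wittBlock_val, wittBlock_val]
  refine wittBlockNat_mono_pos S (wittPos_le_of_stdWittEquiv_le ?_)
  rw [Fin.le_iff_val_le_val, ← val_stdWittEquivFin h, ← val_stdWittEquivFin h, Equiv.apply_symm_apply, Equiv.apply_symm_apply]
  exact hkl

end StdFrame

/-! ## ED. 2 (append-only): the `hstd` docking lemmas for ★ `K2E3WittStandardIndexing` (K2E3-p10) -/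

section StdHyp

variable (r m : ℕ)

/-- **`stdWittEquiv` IS a standard indexing** in the sense of ★ `K2E3WittStandardIndexing` (hypothesis `hstd`, verbatim shape): values `i ∣ r + u ∣ r + m + j`.
[cite: Borel1991, §23] -/
theorem stdWittEquiv_hstd : ∀ x : WittIndex r m, (stdWittEquiv r m x).val =
    Sum.elim (fun i : Fin r => i.val) (Sum.elim (fun u : Fin m => r + u.val) (fun j : Fin r => r + m + j.val)) x := by
  rintro (i | u | j)
  · simp
  · simp
  · simp only [stdWittEquiv_inr_inr, Fin.val_natAdd, Sum.elim_inr]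
    omega

/-- **`stdWittEquivFin h` IS a standard indexing** of `Fin N` (`h : r + (m + r) = N`; hypothesis `hstd` of ★ `K2E3WittStandardIndexing`, verbatim shape), so that
★ `monotone_wittBlockOn_of_std`, ★ `borelU_le_wittParabolic_of_std`, ★ `exists_wittParabolic_mul_mem_cmLocalIntegralLevel` (the driver's `hGC`) and, for
`m ≤ 1`, ★ `wittFormOn_eq_antidiag_of_std[_zero]` (`wittFormOn = Φ_N`) apply to the named frame. [cite: Borel1991, §23] -/
theorem stdWittEquivFin_hstd {N : ℕ} (h : r + (m + r) = N) : ∀ x : WittIndex r m, (stdWittEquivFin r m h x).val =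
    Sum.elim (fun i : Fin r => i.val) (Sum.elim (fun u : Fin m => r + u.val) (fun j : Fin r => r + m + j.val)) x := fun x => by
  rw [val_stdWittEquivFin]
  exact stdWittEquiv_hstd r m x

/-- The `m = 0` shape of `hstd` (★ `wittFormOn_eq_antidiag_of_std_zero`: last summand `r + j`). [cite: Borel1991, §23] -/
theorem stdWittEquivFin_hstd_zero {N : ℕ} (h : r + (0 + r) = N) : ∀ x : WittIndex r 0, (stdWittEquivFin r 0 h x).val =
    Sum.elim (fun i : Fin r => i.val) (Sum.elim (fun u : Fin 0 => r + u.val) (fun j : Fin r => r + j.val)) x := by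
  rintro (i | u | j)
  · exact stdWittEquivFin_hstd r 0 h (Sum.inl i)
  · exact u.elim0
  · rw [stdWittEquivFin_hstd r 0 h (Sum.inr (Sum.inr j)), Sum.elim_inr, Sum.elim_inr, Sum.elim_inr, Sum.elim_inr, Nat.add_zero]

end StdHyp

end Summit.HodgeConjecture.HodgeConjecture.Cruxes.H413.K2E3LocalUnitaryWitt
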